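import Summits.ResolutionOfSingularities.ResolutionOfSingularities.Theorems.FrobeniusClosingPatchingRelPerfectCoreRungClosure
import Summits.ResolutionOfSingularities.ResolutionOfSingularities.Theorems.FrobeniusClosingPatchingRelPerfectCoreRungSquarePlusLinear
import HarnessLib

/-!
# Crux `PatchingRelPerfect` (stmt-ResolutionOfSingularities-16161), chain w52 — CORE RUNG r1d,
# corollary: monomial complete intersections with exponents in `{1, 2}`, modulo the companion
# of `𝔞 + 𝔪²`

[OURS · L1 W5.2 · rung] With `𝔪 = (z₁, …, z_m, y₁, …, y_k)` generating the maximal ideal of a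
regular local ring `S`, the **monomial complete intersection with exponents in `{1,2}`**

  `I = (z₁, …, z_m, y₁², …, y_k²) = 𝔞 + N₀`,  `𝔞 = (z)`, `N₀ = (y₁², …, y_k²)`,

is a SUP-REDUCTION (r1d `companion_sup_of_reduction`, p472337) of

  `K = 𝔞 + (y)² = 𝔞 + 𝔪²`

(`N₀` is a reduction of `N = (y)²` by r1a's pigeonhole `CoreRung.span_powers_mul_pow_eq_pow`:
`N₀ · (y)^{2r} = (y)^{2r+2}` once `k < 2r + 2`; and `(𝔞 + (y))² ⊆ 𝔞 + (y)²`).  Hence: **whenever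
`𝔞 + 𝔪²` lies in the companion class `𝒞` (some `𝔪`-primary `Q` with a regular blowing up of
`Spec S` along `(𝔞 + 𝔪²) · Q`), so does `I`**, with companion `(𝔞 + 𝔪²)ᵏ · Q`
(`companion_monomialCI_one_two_of_companion`), and every blowing up `T = Bl_I Spec S` satisfies the
conclusion of the blow-up-form open core `AtomDimFourBlowupAt`
(`coreRung_monomialCI_one_two_of_companion`).  The hypothesis on `𝔞 + 𝔪²` is rung r1c (chain
w52, stub-4, in progress at the time of writing: for `z` part of a regular system of parameters,
`Q = 𝔪`, `Bl_{(𝔞 + 𝔪²)·𝔪} Spec S = ` blow-up of the regular centre `ℙ(T_{V(𝔞)}) ⊂ E ≅ ℙⁿ⁻¹` on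
`Bl_𝔪 Spec S`); it is carried here as an EXPLICIT HYPOTHESIS, so this file is an unconditional
implication and becomes an unconditional rung the moment r1c lands (one-line instantiation).
For `n = dim S = 4` the family is `(x₁^{a₁}, …, x₄^{a₄})` with `aᵢ ∈ {1, 2}` (up to the order of
the parameters), e.g. `(x₁, x₂, x₃², x₄²)`, `(x₁, x₂², x₃², x₄²)`; `aᵢ ≡ 2` is r1a, `a = (1,…,1,2)`
and its permutations are r1c's own members.  HONEST SCOPE: exponent vectors in `{1, 2}ⁿ` only;
`{1, d}` (`d ≥ 3`) needs the `d`-step point-tower along the curve `V(𝔞)`, general exponents need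
fan regularity — neither is in the tree.  Pure ideal arithmetic plus r1d; every dimension, every
regular local base.  Nothing here is a statement of the manuscript under review.

## References

* The Stacks Project, Tags 080A, 07ZV. [StacksProject]
* V. Cossart, O. Piltant, J. Algebra 529 (2019), Ch. 2 (arXiv:1412.0868 v1 p. 9: monomial ideals
  in a regular system of parameters). [CossartPiltant2019]
-/

-- `Summit.<Summit>.<Sub>.Theorems` with `Sub = Summit` (single-conjunct summit, D-0017)
set_option linter.dupNamespace false

noncomputable section

open CategoryTheory CategoryTheory.Limits AlgebraicGeometry Literature.AlgebraicGeometry.Resolution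

namespace Summit.ResolutionOfSingularities.ResolutionOfSingularities.Theorems

universe u

namespace CoreRungMonomialCI

/-- **The squares of the generators are a reduction of the square**: for `Y = (y₁, …, y_k)` and
`k < 2r + 2`, `(y₁², …, y_k²) · (Y²)ʳ = (Y²)ʳ⁺¹` (r1a's pigeonhole with exponent `2`).
[folklore] -/
theorem span_sq_mul_pow_sq_eq {S : Type u} [CommRing S] {k : ℕ} (y : Fin k → S) {r : ℕ}
    (hr : k < 2 * r + 2) :
    Ideal.span (Set.range fun j => y j ^ 2) * (Ideal.span (Set.range y) ^ 2) ^ r =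
      (Ideal.span (Set.range y) ^ 2) ^ (r + 1) := by
  rw [← pow_mul, ← pow_mul, show 2 * (r + 1) = 2 + 2 * r by ring]
  exact CoreRung.span_powers_mul_pow_eq_pow y rfl (by omega)

/-- The squares of the generators lie in the square: `(y₁², …, y_k²) ⊆ (y)²`. [folklore] -/
theorem span_sq_le_sq {S : Type u} [CommRing S] {k : ℕ} (y : Fin k → S) :
    Ideal.span (Set.range fun j => y j ^ 2) ≤ Ideal.span (Set.range y) ^ 2 := by
  rw [Ideal.span_le]
  rintro _ ⟨j, rfl⟩
  exact Ideal.pow_mem_pow (Ideal.subset_span (Set.mem_range_self j)) 2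

/-- `𝔞 + Y² = 𝔞 + (𝔞 + Y)²`: modulo `𝔞`, the square of `𝔞 + Y` is the square of `Y`.
[folklore] -/
theorem sup_sq_eq_sup_sup_sq {S : Type u} [CommSemiring S] (𝔞 Y : Ideal S) :
    𝔞 ⊔ Y ^ 2 = 𝔞 ⊔ (𝔞 ⊔ Y) ^ 2 := by
  apply le_antisymm
  · exact sup_le_sup_left (Ideal.pow_right_mono le_sup_right 2) 𝔞
  · refine sup_le le_sup_left ?_
    rw [pow_two, Ideal.mul_sup, Ideal.sup_mul, Ideal.sup_mul]
    refine sup_le (sup_le ?_ ?_) (sup_le ?_ ?_)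
    · exact le_sup_of_le_left Ideal.mul_le_right
    · exact le_sup_of_le_left Ideal.mul_le_left
    · exact le_sup_of_le_left Ideal.mul_le_right
    · exact le_sup_of_le_right (by rw [pow_two])

end CoreRungMonomialCI

open CoreRungMonomialCI

/-- **Monomial complete intersections with exponents in `{1,2}` are in the companion class, modulo
`𝔞 + 𝔪²`.** Let `S` be a local ring with `𝔪 = (z₁, …, z_m) + (y₁, …, y_k)`, `𝔞 = (z)`.  If
`𝔞 + 𝔪²` has an `𝔪`-primary companion `Q ⊇ 𝔪^{m'}` with a regular blowing up of `Spec S` along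
`(𝔞 + 𝔪²) · Q`, then `I = (z₁, …, z_m) + (y₁², …, y_k²)` has the `𝔪`-primary companion
`(𝔞 + 𝔪²)ᵏ · Q` with the same regular model (`I` is a sup-reduction of `𝔞 + (y)² = 𝔞 + 𝔪²` with
exponent `k`). [cite: StacksProject, Tag 080A] -/
theorem companion_monomialCI_one_two_of_companion {S : Type u} [CommRing S] [IsLocalRing S]
    {m k : ℕ} (z : Fin m → S) (y : Fin k → S)
    (hzy : Ideal.span (Set.range z) ⊔ Ideal.span (Set.range y) = IsLocalRing.maximalIdeal S)
    (hC : ∃ (Q : Ideal S) (m' : ℕ), IsLocalRing.maximalIdeal S ^ m' ≤ Q ∧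
      ∃ (B : Scheme.{u}) (b : B ⟶ Spec (.of S)),
        IsBlowup b (affineBlowup.idealSheaf
          ((Ideal.span (Set.range z) ⊔ IsLocalRing.maximalIdeal S ^ 2) * Q)) ∧
        Scheme.IsRegular B) :
    ∃ (Q : Ideal S) (m' : ℕ), IsLocalRing.maximalIdeal S ^ m' ≤ Q ∧
      ∃ (B : Scheme.{u}) (b : B ⟶ Spec (.of S)),
        IsBlowup b (affineBlowup.idealSheaf
          ((Ideal.span (Set.range z) ⊔ Ideal.span (Set.range fun j => y j ^ 2)) * Q)) ∧
        Scheme.IsRegular B := by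
  have hK : Ideal.span (Set.range z) ⊔ Ideal.span (Set.range y) ^ 2 =
      Ideal.span (Set.range z) ⊔ IsLocalRing.maximalIdeal S ^ 2 := by
    rw [← hzy]
    exact sup_sq_eq_sup_sup_sq _ _
  have hKm : IsLocalRing.maximalIdeal S ^ 2 ≤
      Ideal.span (Set.range z) ⊔ Ideal.span (Set.range y) ^ 2 := by
    rw [hK]
    exact le_sup_right
  rw [← hK] at hC
  exact companion_sup_of_reduction (span_sq_le_sq y)
    (span_sq_mul_pow_sq_eq y (r := k) (by omega)) hKm hC

/-- **CORE RUNG r1d — monomial complete intersections with exponents in `{1,2}`, modulo r1c.**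
Let `S` be a regular local ring with `𝔪 = (z₁, …, z_m, y₁, …, y_k)` and suppose `(z) + 𝔪²` has an
`𝔪`-primary companion (rung r1c: `Q = 𝔪` when `z` is part of a regular system of parameters).
Then every blowing up `f : T ⟶ Spec S` along the non-zero ideal `I = (z₁, …, z_m, y₁², …, y_k²)`
satisfies the conclusion of the blow-up-form open core `AtomDimFourBlowupAt`: a non-zero ideal
sheaf on `T` cosupported in the closed fibre with regular blowing up (`J = (z + 𝔪²)ᵏ Q 𝒪_T`).
In dimension `4`: `(x₁^{a₁}, …, x₄^{a₄})`, `aᵢ ∈ {1, 2}`.  Every dimension, every regular local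
base; FORMAT evidence for the core on this toric stratum, conditional on r1c only.
[cite: StacksProject, Tag 080A] -/
theorem coreRung_monomialCI_one_two_of_companion {S : Type u} [CommRing S] [IsRegularLocalRing S]
    {m k : ℕ} (z : Fin m → S) (y : Fin k → S)
    (hzy : Ideal.span (Set.range z) ⊔ Ideal.span (Set.range y) = IsLocalRing.maximalIdeal S)
    (hC : ∃ (Q : Ideal S) (m' : ℕ), IsLocalRing.maximalIdeal S ^ m' ≤ Q ∧
      ∃ (B : Scheme.{u}) (b : B ⟶ Spec (.of S)),
        IsBlowup b (affineBlowup.idealSheaf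
          ((Ideal.span (Set.range z) ⊔ IsLocalRing.maximalIdeal S ^ 2) * Q)) ∧
        Scheme.IsRegular B)
    (hI : Ideal.span (Set.range z) ⊔ Ideal.span (Set.range fun j => y j ^ 2) ≠ ⊥)
    (T : Scheme.{u}) (f : T ⟶ Spec (.of S))
    (hf : IsBlowup f (affineBlowup.idealSheaf
      (Ideal.span (Set.range z) ⊔ Ideal.span (Set.range fun j => y j ^ 2)))) :
    ∃ (J : T.IdealSheafData) (T' : Scheme.{u}) (π : T' ⟶ T), J ≠ ⊥ ∧
      (∀ t : T, t ∈ J.support → f.base t = IsLocalRing.closedPoint S) ∧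
      IsBlowup π J ∧ Scheme.IsRegular T' :=
  atomConclusion_of_companion' hI (companion_monomialCI_one_two_of_companion z y hzy hC) T f hf


/-! ## Instantiation with rung r1c (`…CoreRungSquarePlusLinear`, stub-4): the UNCONDITIONAL rung

With `x = (z₁, …, z_m, y₁, …, y_e)` a regular system of parameters (`(span x) = 𝔪`,
`spanFinrank 𝔪 = m + e`), r1c's `isRegular_of_isBlowup_sqSup_mul_maximal` says that every blowing
up of `Spec S` along `(𝔪² + (z)) · 𝔪` is regular, i.e. `(z) + 𝔪²` has the companion `Q = 𝔪`.
Feeding this into `companion_monomialCI_one_two_of_companion` discharges its hypothesis. -/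

section WithRsop

variable {S : Type u} [CommRing S] [IsRegularLocalRing S] {m e : ℕ} (x : Fin (m + e) → S)
  (hx : Ideal.span (Set.range x) = IsLocalRing.maximalIdeal S)
  (hd : (IsLocalRing.maximalIdeal S).spanFinrank = m + e)

omit [CommRing S] [IsRegularLocalRing S] in
/-- The range of `x : Fin (m + e) → S` is the union of the ranges of its two blocks
`z = x ∘ Fin.castAdd e` and `y = x ∘ Fin.natAdd m`. [folklore] -/
theorem CoreRungMonomialCI.range_eq_union_castAdd_natAdd :
    Set.range x = Set.range (fun j : Fin m => x (Fin.castAdd e j)) ∪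
      Set.range (fun k : Fin e => x (Fin.natAdd m k)) := by
  ext a
  constructor
  · rintro ⟨i, rfl⟩
    induction i using Fin.addCases with
    | left j => exact Or.inl ⟨j, rfl⟩
    | right k => exact Or.inr ⟨k, rfl⟩
  · rintro (⟨j, rfl⟩ | ⟨k, rfl⟩)
    · exact ⟨_, rfl⟩
    · exact ⟨_, rfl⟩

include hx in
/-- `(z) + (y) = 𝔪` for the two blocks of a generating family `x = (z, y)` of `𝔪`. [folklore] -/
theorem CoreRungMonomialCI.span_castAdd_sup_span_natAdd :
    Ideal.span (Set.range fun j : Fin m => x (Fin.castAdd e j)) ⊔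
      Ideal.span (Set.range fun k : Fin e => x (Fin.natAdd m k)) = IsLocalRing.maximalIdeal S := by
  rw [← Ideal.span_union, ← CoreRungMonomialCI.range_eq_union_castAdd_natAdd x, hx]

include hx hd in
/-- **r1c as a companion datum**: for a regular system of parameters `x = (z, y)`, the ideal
`(z) + 𝔪²` has the `𝔪`-primary companion `Q = 𝔪` — some (indeed every) blowing up of `Spec S`
along `((z) + 𝔪²) · 𝔪` is regular (stub-4's `isRegular_of_isBlowup_sqSup_mul_maximal`: `Bl_𝔪`
followed by the blow-up of the regular centre `ℙ(T_{V(z)}) ⊆ E`).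
[cite: StacksProject, Tag 080A] [cite: Liu2002, Thm. 8.1.19 (a)] -/
theorem companion_span_castAdd_sup_sq_maximalIdeal :
    ∃ (Q : Ideal S) (m' : ℕ), IsLocalRing.maximalIdeal S ^ m' ≤ Q ∧
      ∃ (B : Scheme.{u}) (b : B ⟶ Spec (.of S)),
        IsBlowup b (affineBlowup.idealSheaf
          ((Ideal.span (Set.range fun j : Fin m => x (Fin.castAdd e j)) ⊔
            IsLocalRing.maximalIdeal S ^ 2) * Q)) ∧
        Scheme.IsRegular B := by
  obtain ⟨B, b, hb⟩ := exists_isBlowup (Spec (.of S)) (affineBlowup.idealSheaf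
    ((Ideal.span (Set.range fun j : Fin m => x (Fin.castAdd e j)) ⊔
      IsLocalRing.maximalIdeal S ^ 2) * IsLocalRing.maximalIdeal S))
  refine ⟨IsLocalRing.maximalIdeal S, 1, by rw [pow_one], B, b, hb, ?_⟩
  have hb' : IsBlowup b (affineBlowup.idealSheaf
      ((Ideal.span (Set.range x) ^ 2 ⊔
        Ideal.span (Set.range fun j : Fin m => x (Fin.castAdd e j))) *
        Ideal.span (Set.range x))) := by
    rw [hx, sup_comm]
    exact hb
  exact isRegular_of_isBlowup_sqSup_mul_maximal x hx hd hb'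

include hx hd in
/-- **Monomial complete intersections with exponents in `{1,2}` are in the companion class**
(unconditional): for a regular system of parameters `x = (z₁, …, z_m, y₁, …, y_e)` of a regular
local ring `S`, the ideal `I = (z₁, …, z_m, y₁², …, y_e²)` has an `𝔪`-primary companion
(`((z) + 𝔪²)ᵉ · 𝔪`) with a regular blowing up of `Spec S` along `I · Q`.
[cite: StacksProject, Tag 080A] [cite: Liu2002, Thm. 8.1.19 (a)] -/
theorem companion_monomialCI_one_two :
    ∃ (Q : Ideal S) (m' : ℕ), IsLocalRing.maximalIdeal S ^ m' ≤ Q ∧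
      ∃ (B : Scheme.{u}) (b : B ⟶ Spec (.of S)),
        IsBlowup b (affineBlowup.idealSheaf
          ((Ideal.span (Set.range fun j : Fin m => x (Fin.castAdd e j)) ⊔
            Ideal.span (Set.range fun k : Fin e => x (Fin.natAdd m k) ^ 2)) * Q)) ∧
        Scheme.IsRegular B :=
  companion_monomialCI_one_two_of_companion (fun j : Fin m => x (Fin.castAdd e j))
    (fun k : Fin e => x (Fin.natAdd m k))
    (CoreRungMonomialCI.span_castAdd_sup_span_natAdd x hx)
    (companion_span_castAdd_sup_sq_maximalIdeal x hx hd)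

include hx in
/-- In positive dimension the ideal `(z₁, …, z_m, y₁², …, y_e²)` is non-zero (`S` is a domain and
some parameter is non-zero as soon as `𝔪 ≠ 0`). [folklore] -/
theorem monomialCI_one_two_ne_bot (h𝔪 : IsLocalRing.maximalIdeal S ≠ ⊥) :
    Ideal.span (Set.range fun j : Fin m => x (Fin.castAdd e j)) ⊔
      Ideal.span (Set.range fun k : Fin e => x (Fin.natAdd m k) ^ 2) ≠ ⊥ := by
  haveI : IsDomain S := isDomain_of_isRegularLocalRing S
  intro h
  apply h𝔪
  rw [← hx, Ideal.span_eq_bot]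
  rintro _ ⟨i, rfl⟩
  induction i using Fin.addCases with
  | left j =>
    have hj : x (Fin.castAdd e j) ∈ (⊥ : Ideal S) :=
      h ▸ Ideal.mem_sup_left (Ideal.subset_span (Set.mem_range_self j))
    simpa using hj
  | right k =>
    have hk : x (Fin.natAdd m k) ^ 2 ∈ (⊥ : Ideal S) :=
      h ▸ Ideal.mem_sup_right (Ideal.subset_span (Set.mem_range_self k))
    exact pow_eq_zero_iff (n := 2) two_ne_zero |>.mp (by simpa using hk)

include hx hd in
/-- **CORE RUNG r1d — monomial complete intersections with exponents in `{1,2}`, UNCONDITIONAL.**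
For a regular local ring `S` with regular system of parameters `x = (z₁, …, z_m, y₁, …, y_e)` and
`I = (z₁, …, z_m, y₁², …, y_e²) ≠ 0`, every blowing up `f : T ⟶ Spec S` along `I` satisfies the
conclusion of the blow-up-form open core `AtomDimFourBlowupAt`: a non-zero ideal sheaf on `T`
cosupported in the closed fibre with regular blowing up (companion `((z) + 𝔪²)ᵉ · 𝔪`, i.e.
`J = ((z) + 𝔪²)ᵉ 𝔪 𝒪_T`; model: `Bl_𝔪` followed by the blow-up of `ℙ(T_{V(z)}) ⊆ E`).  In
dimension `4`: `(x₁^{a₁}, …, x₄^{a₄})` with every `aᵢ ∈ {1, 2}`.  Every dimension, every regular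
local base; FORMAT evidence for the core on this toric stratum (rungs r1c + r1d).
[cite: StacksProject, Tag 080A] [cite: Liu2002, Thm. 8.1.19 (a)] -/
theorem coreRung_monomialCI_one_two
    (hI : Ideal.span (Set.range fun j : Fin m => x (Fin.castAdd e j)) ⊔
      Ideal.span (Set.range fun k : Fin e => x (Fin.natAdd m k) ^ 2) ≠ ⊥)
    (T : Scheme.{u}) (f : T ⟶ Spec (.of S))
    (hf : IsBlowup f (affineBlowup.idealSheaf
      (Ideal.span (Set.range fun j : Fin m => x (Fin.castAdd e j)) ⊔
        Ideal.span (Set.range fun k : Fin e => x (Fin.natAdd m k) ^ 2)))) :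
    ∃ (J : T.IdealSheafData) (T' : Scheme.{u}) (π : T' ⟶ T), J ≠ ⊥ ∧
      (∀ t : T, t ∈ J.support → f.base t = IsLocalRing.closedPoint S) ∧
      IsBlowup π J ∧ Scheme.IsRegular T' :=
  atomConclusion_of_companion' hI (companion_monomialCI_one_two x hx hd) T f hf

end WithRsop

/-- **The registered core's binder shape, restricted to the family.** With exactly the hypotheses
of `stub_atomDimFourBlowup` (`S` regular local of characteristic `p`, `𝔪`-adically complete,
perfect residue field, `dim S = 4`; `I ≠ 0`; `T` a blowing up of `Spec S` along `I`, regular off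
the closed fibre) and `I = (z₁, …, z_m, y₁², …, y_e²)` for a regular system of parameters
`(z, y)`, the core's conclusion holds.  The dimension, characteristic, completeness, residue-field
and off-fibre hypotheses are not used (underscored). [cite: StacksProject, Tag 080A] -/
theorem atomDimFourBlowupAt_monomialCI_one_two (p : ℕ) (_hp : p.Prime) (S : Type)
    [CommRing S] [IsRegularLocalRing S] [CharP S p]
    [IsAdicComplete (IsLocalRing.maximalIdeal S) S]
    [PerfectField (IsLocalRing.ResidueField S)] (_hS : ringKrullDim S = (4 : ℕ))
    {m e : ℕ} (x : Fin (m + e) → S)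
    (hx : Ideal.span (Set.range x) = IsLocalRing.maximalIdeal S)
    (hd : (IsLocalRing.maximalIdeal S).spanFinrank = m + e)
    (hI : Ideal.span (Set.range fun j : Fin m => x (Fin.castAdd e j)) ⊔
      Ideal.span (Set.range fun k : Fin e => x (Fin.natAdd m k) ^ 2) ≠ ⊥)
    (T : Scheme.{0}) (f : T ⟶ Spec (.of S))
    (hf : IsBlowup f (affineBlowup.idealSheaf
      (Ideal.span (Set.range fun j : Fin m => x (Fin.castAdd e j)) ⊔
        Ideal.span (Set.range fun k : Fin e => x (Fin.natAdd m k) ^ 2))))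
    (_hoff : ∀ t : T, f.base t ≠ IsLocalRing.closedPoint S →
      IsRegularLocalRing (T.presheaf.stalk t)) :
    ∃ (J : T.IdealSheafData) (T' : Scheme.{0}) (π : T' ⟶ T), J ≠ ⊥ ∧
      (∀ t : T, t ∈ J.support → f.base t = IsLocalRing.closedPoint S) ∧
      IsBlowup π J ∧ Scheme.IsRegular T' :=
  coreRung_monomialCI_one_two x hx hd hI T f hf

end Summit.ResolutionOfSingularities.ResolutionOfSingularities.Theorems

end
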